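import Summits.ResolutionOfSingularities.ResolutionOfSingularities.Theorems.PurelyInseparableDim4JointTwoHostsComputations
import HarnessLib

/-!
# Purely inseparable four-folds: chart computations for the TWO-HOSTS certificate — host charts, the waiting kid, its dead charts
# (brick S3 (c) «joint point∘coordinate chains», part 57b; cell `res-dim4-pi`)

[OURS · counted 0] (D-0157 DOOR 2; desk WORD #66 (4)(c), #74 (g), #99 (d); frame `PIDim4.TerminationImpliesOrderReduction`, S3 (c) v3;
host item stmt-ResolutionOfSingularities-16155, helper). Nothing here proves resolution of singularities in dimension ≥ 4 / characteristic
`p` — NOT here, not anywhere in this programme. Continuation of part 57a for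
`F_ε = x₁^{2p} x₄ + ε x₁^p x₄ + x₁² x₂^{p−1} x₃^{p−1} + ε x₁ x₂^{p−1} x₃^{p−1}`, host `S = {x₁, x₂}`, waiting set `T = {x₁, x₃}`, `ε ≠ 0`:

* `chartExponent_*_four` — the chart exponent law on four-exponent monomials;
* host chart `x₁`: `chartTransform_S0_twoHosts`, dead (`not_isEquimultiplePoint_S0_twoHosts`, `∂_{x₄} = ε` on the divisor);
* host chart `x₂`: `chartTransform_S1_twoHosts` (`H_ε`), `cases_S1_twoHosts` (equimultiple on the divisor ⇒ `y₁ = y₃ = 0`),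
  `isClean_H_twoHosts`, `step_S1_twoHosts` (the waiting kid's state is `H_ε`);
* the waiting kid's blow-up along `T`: `chartTransform_T0_H_twoHosts` / `not_isEquimultiplePoint_T0_twoHosts` (`∂_{y₄} = ε`),
  `chartTransform_T2_H_twoHosts` / `not_isEquimultiplePoint_T2_twoHosts` (`∂_{y₁} = ε`).

AI-produced formalisation, weaker than expert review. bears_on: LADDER-RESOLUTION:D157-DOOR2 (res-dim4-pi · S3 (c) joint v3 · instance).
-/

set_option linter.dupNamespace false -- D-0017: single-problem summit path `Summit.<S>.<S>.…` by design

noncomputable section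

open MvPolynomial Finset

namespace Summit.ResolutionOfSingularities.ResolutionOfSingularities.Theorems.PIDim4

open Literature.AlgebraicGeometry.Resolution
open Literature.AlgebraicGeometry.Resolution.Hauser2010
open Literature.AlgebraicGeometry.Resolution.AffinePointBlowup (P A γ coord Wtop ξ)

namespace Equimultiple

section TwoHostsCharts

variable {K : Type} [Field K] {p : ℕ} [hp : Fact p.Prime] [CharP K p]

/-! ## §1 The chart exponent law on four-exponent monomials -/

omit hp [CharP K p] in
/-- Chart `x₁` of the blow-up of `V(x₁, x₂)`. [cite: HauserPerlega2019PRIMS, §2 (the x₁-chart)] -/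
theorem chartExponent_S0_four (a b c d : ℕ) :
    CentreBlowup.chartExponent p ({0, 1} : Finset (Fin 4)) 0
        (Finsupp.single 0 a + Finsupp.single 1 b + Finsupp.single 2 c + Finsupp.single 3 d) =
      Finsupp.single 0 (a + b - p) + Finsupp.single 1 b + Finsupp.single 2 c + Finsupp.single 3 d := by
  ext i; fin_cases i <;> simp [CentreBlowup.chartExponent, Finsupp.update_apply, CentreBlowup.degIn_pair]

omit hp [CharP K p] in
/-- Chart `x₂` of the blow-up of `V(x₁, x₂)`. [cite: HauserPerlega2019PRIMS, §2 (the x₁-chart)] -/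
theorem chartExponent_S1_four (a b c d : ℕ) :
    CentreBlowup.chartExponent p ({0, 1} : Finset (Fin 4)) 1
        (Finsupp.single 0 a + Finsupp.single 1 b + Finsupp.single 2 c + Finsupp.single 3 d) =
      Finsupp.single 0 a + Finsupp.single 1 (a + b - p) + Finsupp.single 2 c + Finsupp.single 3 d := by
  ext i; fin_cases i <;> simp [CentreBlowup.chartExponent, Finsupp.update_apply, CentreBlowup.degIn_pair]

omit hp [CharP K p] in
/-- Chart `y₁` of the blow-up of `V(y₁, y₃)`. [cite: HauserPerlega2019PRIMS, §2 (the x₁-chart)] -/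
theorem chartExponent_T0_four (a b c d : ℕ) :
    CentreBlowup.chartExponent p ({0, 2} : Finset (Fin 4)) 0
        (Finsupp.single 0 a + Finsupp.single 1 b + Finsupp.single 2 c + Finsupp.single 3 d) =
      Finsupp.single 0 (a + c - p) + Finsupp.single 1 b + Finsupp.single 2 c + Finsupp.single 3 d := by
  ext i; fin_cases i <;> simp [CentreBlowup.chartExponent, Finsupp.update_apply, CentreBlowup.degIn_pair]

omit hp [CharP K p] in
/-- Chart `y₃` of the blow-up of `V(y₁, y₃)`. [cite: HauserPerlega2019PRIMS, §2 (the x₁-chart)] -/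
theorem chartExponent_T2_four (a b c d : ℕ) :
    CentreBlowup.chartExponent p ({0, 2} : Finset (Fin 4)) 2
        (Finsupp.single 0 a + Finsupp.single 1 b + Finsupp.single 2 c + Finsupp.single 3 d) =
      Finsupp.single 0 a + Finsupp.single 1 b + Finsupp.single 2 (a + c - p) + Finsupp.single 3 d := by
  ext i; fin_cases i <;> simp [CentreBlowup.chartExponent, Finsupp.update_apply, CentreBlowup.degIn_pair]

/-! ## §2 The host's charts -/

omit hp [CharP K p] in
/-- **Host chart `x₁`**: `F_ε ↦ x₁^p x₄ + ε x₄ + x₁ x₂^{p−1} x₃^{p−1} + ε x₂^{p−1} x₃^{p−1}`. [cite: HauserPerlega2019PRIMS, §2 (the x₁-chart)] -/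
theorem chartTransform_S0_twoHosts (hp1 : 1 ≤ p) (ε : K) :
    CentreBlowup.chartTransform p ({0, 1} : Finset (Fin 4)) 0
        (X 0 ^ (2 * p) * X 3 + C ε * (X 0 ^ p * X 3) + X 0 ^ 2 * X 1 ^ (p - 1) * X 2 ^ (p - 1) +
          C ε * (X 0 * X 1 ^ (p - 1) * X 2 ^ (p - 1)) : MvPolynomial (Fin 4) K) =
      C 1 * (X 0 ^ p * X 1 ^ 0 * X 2 ^ 0 * X 3 ^ 1) + C ε * (X 0 ^ 0 * X 1 ^ 0 * X 2 ^ 0 * X 3 ^ 1) +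
        C 1 * (X 0 ^ 1 * X 1 ^ (p - 1) * X 2 ^ (p - 1) * X 3 ^ 0) + C ε * (X 0 ^ 0 * X 1 ^ (p - 1) * X 2 ^ (p - 1) * X 3 ^ 0) := by
  rw [twoHosts_eq]
  simp only [C_mul_X_pow_four, CentreBlowup.chartTransform_add, CentreBlowup.chartTransform_monomial, chartExponent_S0_four]
  rw [show 2 * p + 0 - p = p by omega, show p + 0 - p = 0 by omega, show 2 + (p - 1) - p = 1 by omega,
    show 1 + (p - 1) - p = 0 by omega]

omit hp [CharP K p] in
/-- **Host chart `x₂`**: `F_ε ↦ H_ε = y₁^{2p} y₂^p y₄ + ε y₁^p y₄ + y₁² y₂ y₃^{p−1} + ε y₁ y₃^{p−1}`. [cite: HauserPerlega2019PRIMS, §2 (the x₁-chart)] -/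
theorem chartTransform_S1_twoHosts (hp1 : 1 ≤ p) (ε : K) :
    CentreBlowup.chartTransform p ({0, 1} : Finset (Fin 4)) 1
        (X 0 ^ (2 * p) * X 3 + C ε * (X 0 ^ p * X 3) + X 0 ^ 2 * X 1 ^ (p - 1) * X 2 ^ (p - 1) +
          C ε * (X 0 * X 1 ^ (p - 1) * X 2 ^ (p - 1)) : MvPolynomial (Fin 4) K) =
      C 1 * (X 0 ^ (2 * p) * X 1 ^ p * X 2 ^ 0 * X 3 ^ 1) + C ε * (X 0 ^ p * X 1 ^ 0 * X 2 ^ 0 * X 3 ^ 1) +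
        C 1 * (X 0 ^ 2 * X 1 ^ 1 * X 2 ^ (p - 1) * X 3 ^ 0) + C ε * (X 0 ^ 1 * X 1 ^ 0 * X 2 ^ (p - 1) * X 3 ^ 0) := by
  rw [twoHosts_eq]
  simp only [C_mul_X_pow_four, CentreBlowup.chartTransform_add, CentreBlowup.chartTransform_monomial, chartExponent_S1_four]
  rw [show 2 * p + 0 - p = p by omega, show p + 0 - p = 0 by omega, show 2 + (p - 1) - p = 1 by omega,
    show 1 + (p - 1) - p = 0 by omega]

omit [CharP K p] in
/-- **Host chart `x₁` is DEAD**: on the divisor (`b₁ = 0`) the coefficient of `x₄` is `b₁^p + ε = ε ≠ 0`.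
[cite: Hauser2010, §F (equiconstant points)] -/
theorem not_isEquimultiplePoint_S0_twoHosts [DecidableEq K] {ε : K} (hε : ε ≠ 0) (b : Fin 4 → K) (hb : b 0 = 0)
    (s : State K) (hs : s.F = X 0 ^ (2 * p) * X 3 + C ε * (X 0 ^ p * X 3) + X 0 ^ 2 * X 1 ^ (p - 1) * X 2 ^ (p - 1) +
      C ε * (X 0 * X 1 ^ (p - 1) * X 2 ^ (p - 1))) :
    ¬ CentreBlowup.IsEquimultiplePoint p ({0, 1} : Finset (Fin 4)) 0 b s := by
  have hp0 : p ≠ 0 := hp.out.ne_zero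
  intro h
  unfold CentreBlowup.IsEquimultiplePoint CentreBlowup.pointTransform at h
  rw [hs, chartTransform_S0_twoHosts hp.out.one_lt.le] at h
  have h3 := eval_pderiv_eq_zero_of_forall_coeff b _ h 3
  simp [(pderiv (3 : Fin 4)).leibniz_pow, hb, hp0] at h3
  exact hε h3

set_option linter.unusedSimpArgs false in
/-- **Host chart `x₂`: the equimultiple points of the divisor lie on the waiting kid** — `b₂ = 0` and equimultiplicity give
`ε b₁^p = 0` (coefficient of `y₄`) and `ε b₃^{p−1} = 0` (coefficient of `y₁`), so `b₁ = b₃ = 0`. [cite: Hauser2010, §F (equiconstant points)] -/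
theorem cases_S1_twoHosts [DecidableEq K] {ε : K} (hε : ε ≠ 0) {b : Fin 4 → K} (s : State K)
    (hs : s.F = X 0 ^ (2 * p) * X 3 + C ε * (X 0 ^ p * X 3) + X 0 ^ 2 * X 1 ^ (p - 1) * X 2 ^ (p - 1) +
      C ε * (X 0 * X 1 ^ (p - 1) * X 2 ^ (p - 1)))
    (h : CentreBlowup.IsEquimultiplePoint p ({0, 1} : Finset (Fin 4)) 1 b s) (hb : b 1 = 0) : b 0 = 0 ∧ b 2 = 0 := by
  have hp0 : p ≠ 0 := hp.out.ne_zero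
  have hpK : (p : K) = 0 := CharP.cast_eq_zero K p
  unfold CentreBlowup.IsEquimultiplePoint CentreBlowup.pointTransform at h
  rw [hs, chartTransform_S1_twoHosts hp.out.one_lt.le] at h
  have h3 := eval_pderiv_eq_zero_of_forall_coeff b _ h 3
  have h0 := eval_pderiv_eq_zero_of_forall_coeff b _ h 0
  simp [(pderiv (3 : Fin 4)).leibniz_pow, (pderiv (0 : Fin 4)).leibniz_pow, hb, hp0, hpK, hε] at h3 h0
  exact ⟨h3, h0.1⟩

/-! ## §3 The waiting kid and its dead charts -/

omit hp [CharP K p] in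
/-- The support of `H_ε`. [folklore] -/
theorem mem_support_H_twoHosts (ε : K) {e : Fin 4 →₀ ℕ}
    (he : e ∈ (C 1 * (X 0 ^ (2 * p) * X 1 ^ p * X 2 ^ 0 * X 3 ^ 1) + C ε * (X 0 ^ p * X 1 ^ 0 * X 2 ^ 0 * X 3 ^ 1) +
        C 1 * (X 0 ^ 2 * X 1 ^ 1 * X 2 ^ (p - 1) * X 3 ^ 0) + C ε * (X 0 ^ 1 * X 1 ^ 0 * X 2 ^ (p - 1) * X 3 ^ 0) :
          MvPolynomial (Fin 4) K).support) :
    e = Finsupp.single 0 (2 * p) + Finsupp.single 1 p + Finsupp.single 2 0 + Finsupp.single 3 1 ∨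
      e = Finsupp.single 0 p + Finsupp.single 1 0 + Finsupp.single 2 0 + Finsupp.single 3 1 ∨
      e = Finsupp.single 0 2 + Finsupp.single 1 1 + Finsupp.single 2 (p - 1) + Finsupp.single 3 0 ∨
      e = Finsupp.single 0 1 + Finsupp.single 1 0 + Finsupp.single 2 (p - 1) + Finsupp.single 3 0 := by
  rw [C_mul_X_pow_four, C_mul_X_pow_four, C_mul_X_pow_four, C_mul_X_pow_four] at he
  rcases Finset.mem_union.mp (Finset.mem_of_subset MvPolynomial.support_add he) with h | h
  · rcases Finset.mem_union.mp (Finset.mem_of_subset MvPolynomial.support_add h) with h | h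
    · rcases Finset.mem_union.mp (Finset.mem_of_subset MvPolynomial.support_add h) with h | h
      · exact Or.inl (Finset.mem_singleton.mp (Finset.mem_of_subset support_monomial_subset h))
      · exact Or.inr (Or.inl (Finset.mem_singleton.mp (Finset.mem_of_subset support_monomial_subset h)))
    · exact Or.inr (Or.inr (Or.inl (Finset.mem_singleton.mp (Finset.mem_of_subset support_monomial_subset h))))
  · exact Or.inr (Or.inr (Or.inr (Finset.mem_singleton.mp (Finset.mem_of_subset support_monomial_subset h))))

omit [CharP K p] in
/-- **`H_ε` is clean** (exponents `1` of `y₄`, `y₄`, `y₂`, `y₁`). [cite: HauserPerlega2019PRIMS, §2 (cleaning)] -/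
theorem isClean_H_twoHosts (ε : K) :
    Literature.Barriers.ResolutionOfSingularities.HauserPerlega.IsClean p
      (C 1 * (X 0 ^ (2 * p) * X 1 ^ p * X 2 ^ 0 * X 3 ^ 1) + C ε * (X 0 ^ p * X 1 ^ 0 * X 2 ^ 0 * X 3 ^ 1) +
        C 1 * (X 0 ^ 2 * X 1 ^ 1 * X 2 ^ (p - 1) * X 3 ^ 0) + C ε * (X 0 ^ 1 * X 1 ^ 0 * X 2 ^ (p - 1) * X 3 ^ 0) :
          MvPolynomial (Fin 4) K) := by
  intro d hd hpth
  have key1 : ∀ i : Fin 4, d i = 1 → False := fun i hi => by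
    have h := hpth i (by rw [Finsupp.mem_support_iff, hi]; exact one_ne_zero)
    rw [hi] at h
    exact hp.out.one_lt.ne' (Nat.dvd_one.mp h)
  rcases mem_support_H_twoHosts ε hd with rfl | rfl | rfl | rfl
  · exact key1 3 (by simp)
  · exact key1 3 (by simp)
  · exact key1 1 (by simp [show (1 : Fin 4) ≠ 0 by decide])
  · exact key1 0 (by simp)

omit [CharP K p] in
/-- **The waiting kid's state**: `(step p {x₁,x₂} x₂ 0 (F_ε, 0, ∅)).F = H_ε`. [cite: Hauser2010, §§F–G] -/
theorem step_S1_twoHosts [DecidableEq K] (ε : K) :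
    (CentreBlowup.step p ({0, 1} : Finset (Fin 4)) 1 (0 : Fin 4 → K)
        (⟨X 0 ^ (2 * p) * X 3 + C ε * (X 0 ^ p * X 3) + X 0 ^ 2 * X 1 ^ (p - 1) * X 2 ^ (p - 1) +
          C ε * (X 0 * X 1 ^ (p - 1) * X 2 ^ (p - 1)), 0, ∅⟩ : State K)).F =
      C 1 * (X 0 ^ (2 * p) * X 1 ^ p * X 2 ^ 0 * X 3 ^ 1) + C ε * (X 0 ^ p * X 1 ^ 0 * X 2 ^ 0 * X 3 ^ 1) +
        C 1 * (X 0 ^ 2 * X 1 ^ 1 * X 2 ^ (p - 1) * X 3 ^ 0) + C ε * (X 0 ^ 1 * X 1 ^ 0 * X 2 ^ (p - 1) * X 3 ^ 0) := by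
  show deletePthPowers p (PointBlowup.translate (0 : Fin 4 → K) (CentreBlowup.chartTransform p ({0, 1} : Finset (Fin 4)) 1 _)) = _
  rw [chartTransform_S1_twoHosts hp.out.one_lt.le, PointBlowup.translate_zero]
  exact Literature.Barriers.ResolutionOfSingularities.HauserPerlega.deletePthPowers_eq_self (isClean_H_twoHosts ε)

omit hp [CharP K p] in
/-- **Chart `y₁` of the waiting kid's blow-up along `V(y₁, y₃)`** applied to `H_ε`. [cite: HauserPerlega2019PRIMS, §2 (the x₁-chart)] -/
theorem chartTransform_T0_H_twoHosts (hp1 : 1 ≤ p) (ε : K) :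
    CentreBlowup.chartTransform p ({0, 2} : Finset (Fin 4)) 0
        (C 1 * (X 0 ^ (2 * p) * X 1 ^ p * X 2 ^ 0 * X 3 ^ 1) + C ε * (X 0 ^ p * X 1 ^ 0 * X 2 ^ 0 * X 3 ^ 1) +
          C 1 * (X 0 ^ 2 * X 1 ^ 1 * X 2 ^ (p - 1) * X 3 ^ 0) + C ε * (X 0 ^ 1 * X 1 ^ 0 * X 2 ^ (p - 1) * X 3 ^ 0) :
            MvPolynomial (Fin 4) K) =
      C 1 * (X 0 ^ p * X 1 ^ p * X 2 ^ 0 * X 3 ^ 1) + C ε * (X 0 ^ 0 * X 1 ^ 0 * X 2 ^ 0 * X 3 ^ 1) +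
        C 1 * (X 0 ^ 1 * X 1 ^ 1 * X 2 ^ (p - 1) * X 3 ^ 0) + C ε * (X 0 ^ 0 * X 1 ^ 0 * X 2 ^ (p - 1) * X 3 ^ 0) := by
  simp only [C_mul_X_pow_four, CentreBlowup.chartTransform_add, CentreBlowup.chartTransform_monomial, chartExponent_T0_four]
  rw [show 2 * p + 0 - p = p by omega, show p + 0 - p = 0 by omega, show 2 + (p - 1) - p = 1 by omega,
    show 1 + (p - 1) - p = 0 by omega]

omit hp [CharP K p] in
/-- **Chart `y₃` of the waiting kid's blow-up along `V(y₁, y₃)`** applied to `H_ε`. [cite: HauserPerlega2019PRIMS, §2 (the x₁-chart)] -/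
theorem chartTransform_T2_H_twoHosts (hp1 : 1 ≤ p) (ε : K) :
    CentreBlowup.chartTransform p ({0, 2} : Finset (Fin 4)) 2
        (C 1 * (X 0 ^ (2 * p) * X 1 ^ p * X 2 ^ 0 * X 3 ^ 1) + C ε * (X 0 ^ p * X 1 ^ 0 * X 2 ^ 0 * X 3 ^ 1) +
          C 1 * (X 0 ^ 2 * X 1 ^ 1 * X 2 ^ (p - 1) * X 3 ^ 0) + C ε * (X 0 ^ 1 * X 1 ^ 0 * X 2 ^ (p - 1) * X 3 ^ 0) :
            MvPolynomial (Fin 4) K) =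
      C 1 * (X 0 ^ (2 * p) * X 1 ^ p * X 2 ^ p * X 3 ^ 1) + C ε * (X 0 ^ p * X 1 ^ 0 * X 2 ^ 0 * X 3 ^ 1) +
        C 1 * (X 0 ^ 2 * X 1 ^ 1 * X 2 ^ 1 * X 3 ^ 0) + C ε * (X 0 ^ 1 * X 1 ^ 0 * X 2 ^ 0 * X 3 ^ 0) := by
  simp only [C_mul_X_pow_four, CentreBlowup.chartTransform_add, CentreBlowup.chartTransform_monomial, chartExponent_T2_four]
  rw [show 2 * p + 0 - p = p by omega, show p + 0 - p = 0 by omega, show 2 + (p - 1) - p = 1 by omega,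
    show 1 + (p - 1) - p = 0 by omega]

omit [CharP K p] in
/-- **Chart `y₁` of the waiting kid's blow-up is DEAD**: on the divisor (`b₁ = 0`) the coefficient of `y₄` is `ε ≠ 0`.
[cite: Hauser2010, §F (equiconstant points)] -/
theorem not_isEquimultiplePoint_T0_twoHosts [DecidableEq K] {ε : K} (hε : ε ≠ 0) (b : Fin 4 → K) (hb : b 0 = 0)
    (s : State K) (hs : s.F = C 1 * (X 0 ^ (2 * p) * X 1 ^ p * X 2 ^ 0 * X 3 ^ 1) + C ε * (X 0 ^ p * X 1 ^ 0 * X 2 ^ 0 * X 3 ^ 1) +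
      C 1 * (X 0 ^ 2 * X 1 ^ 1 * X 2 ^ (p - 1) * X 3 ^ 0) + C ε * (X 0 ^ 1 * X 1 ^ 0 * X 2 ^ (p - 1) * X 3 ^ 0)) :
    ¬ CentreBlowup.IsEquimultiplePoint p ({0, 2} : Finset (Fin 4)) 0 b s := by
  have hp0 : p ≠ 0 := hp.out.ne_zero
  intro h
  unfold CentreBlowup.IsEquimultiplePoint CentreBlowup.pointTransform at h
  rw [hs, chartTransform_T0_H_twoHosts hp.out.one_lt.le] at h
  have h3 := eval_pderiv_eq_zero_of_forall_coeff b _ h 3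
  simp [(pderiv (3 : Fin 4)).leibniz_pow, hb, hp0] at h3
  exact hε h3

set_option linter.unusedSimpArgs false in
/-- **Chart `y₃` of the waiting kid's blow-up is DEAD**: on the divisor (`b₃ = 0`) the coefficient of `y₁` is `ε ≠ 0`.
[cite: Hauser2010, §F (equiconstant points)] -/
theorem not_isEquimultiplePoint_T2_twoHosts [DecidableEq K] {ε : K} (hε : ε ≠ 0) (b : Fin 4 → K) (hb : b 2 = 0)
    (s : State K) (hs : s.F = C 1 * (X 0 ^ (2 * p) * X 1 ^ p * X 2 ^ 0 * X 3 ^ 1) + C ε * (X 0 ^ p * X 1 ^ 0 * X 2 ^ 0 * X 3 ^ 1) +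
      C 1 * (X 0 ^ 2 * X 1 ^ 1 * X 2 ^ (p - 1) * X 3 ^ 0) + C ε * (X 0 ^ 1 * X 1 ^ 0 * X 2 ^ (p - 1) * X 3 ^ 0)) :
    ¬ CentreBlowup.IsEquimultiplePoint p ({0, 2} : Finset (Fin 4)) 2 b s := by
  have hp0 : p ≠ 0 := hp.out.ne_zero
  have hpK : (p : K) = 0 := CharP.cast_eq_zero K p
  intro h
  unfold CentreBlowup.IsEquimultiplePoint CentreBlowup.pointTransform at h
  rw [hs, chartTransform_T2_H_twoHosts hp.out.one_lt.le] at h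
  have h0 := eval_pderiv_eq_zero_of_forall_coeff b _ h 0
  simp [(pderiv (0 : Fin 4)).leibniz_pow, hb, hp0, hpK] at h0
  exact hε h0

end TwoHostsCharts

end Equimultiple

end Summit.ResolutionOfSingularities.ResolutionOfSingularities.Theorems.PIDim4

end
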